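import Summits.CriticalPhenomena.PercolationContinuityZ3.Theorems.PercNearOneGluingNoHeavyLowerTailThreePointProductForm
import HarnessLib

/-!
# The certificate shape of the PRODUCT FORM `#bad² ≤ #P1·#P2`: hyperbolic demand, pair injections, product Hall
# (Sahi programme, prover prim-sahi-p2 gen 54)

Support file (`--supports stmt-CriticalPhenomena-4575`, helper), continuing `…ThreePointProductForm` (gen 53: CONJECTURE (P), per fibre
`#bad² ≤ #P1·#P2`, and its law-level consequences).  Standard axioms, no sorries, no named facts, no definitions.
Memo `run/shared/lean/prim/prim-sahi/FROM-prim-sahi-p2-gen54-CERTIFICATE-SHAPE.md`, `prim-sahi-p2/PROOF-E3.md` §64.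

WHAT IS PROVED (abstract finite combinatorics; `B` = the bad states, `P`, `Q` = the `sa|c`- and `ac|s`-states of a fibre).
* **`card_sq_le_of_hyperbolicCertificate`** [this work] — the HYPERBOLIC CERTIFICATE: if every `x ∈ P` (resp. `y ∈ Q`) distributes at most one
  unit of mass `m₁ x ·` (resp. `m₂ y ·`) over `B`, and every `t ∈ B` receives `r₁(t) · r₂(t) ≥ 1` (product of the two received masses),
  then `#B² ≤ #P · #Q`.  [Cauchy–Schwarz: `#B ≤ Σ_t √(r₁ r₂) ≤ √(Σ r₁)·√(Σ r₂) ≤ √(#P·#Q)`.]  This is the shape a 'local' proof of (P) must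
  have; gen 44's demand-2 certificates (`r₁ + r₂ ≥ 2`, `two_mul_card_le_of_additiveCertificate`) are its arithmetic-mean shadow
  (`additive_of_hyperbolic`), and a pair injection `B × B ↪ P × Q` (`card_sq_le_of_pairInjOn`) is its integral form.
* **`hyperbolicCertificate_of_card_sq_le`** [this work] — conversely `#B² ≤ #P·#Q` (with `B ≠ ∅`) yields the uniform certificate on the
  complete relations; so (P) per fibre is EQUIVALENT to the existence of a hyperbolic certificate.
* **`card_sq_le_neighbour_card_mul_of_hyperbolicCertificate`** [this work] — PRODUCT HALL CONDITION: a hyperbolic certificate supported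
  on relations `R₁ ⊆ P × B`, `R₂ ⊆ Q × B` forces `#A² ≤ #N₁(A) · #N₂(A)` for every `A ⊆ B` (`Nᵢ(A)` = sources related to `A`).  The memo
  uses it to show that NO certificate for (P) can be supported on monotone relations (`T ⊆ X`): on the fibre 'triangle `h a c` + pendant
  `s h`' the two bad states `{ha}, {sh}` have `#N₁ = 1`, `#N₂ = 3 < 4` along `T ⊆ X` — every certificate must use non-monotone moves (the
  flat `♭`), unlike the arithmetic-mean form FIB32 whose demand-2 matching IS monotone (gen 53 §1).
Nothing here is specific to percolation; the fibre counts enter only through `#B, #P, #Q` and the relations.  [folklore] (Cauchy–Schwarz,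
`Finset.sum_mul_sq_le_sq_mul_sq`); [cite: Gladkov2024, Conjecture 10.1 (p. 18), arXiv:2408.08457] for the conjecture (P) serves.
-/

noncomputable section

open Classical

namespace Summit.CriticalPhenomena.PercolationContinuityZ3.Theorems

namespace ProductFormCertificate

open Finset

variable {ι κ₁ κ₂ : Type*}

/-! ### 1. Hyperbolic certificates give the product form -/

/-- Total mass received by the targets `B` from sources of capacity one is at most the number of sources. [this work] -/
theorem sum_received_le_card (B : Finset ι) (P : Finset κ₁) (m : κ₁ → ι → ℝ)
    (hcap : ∀ x ∈ P, ∑ t ∈ B, m x t ≤ 1) :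
    ∑ t ∈ B, ∑ x ∈ P, m x t ≤ (P.card : ℝ) := by
  rw [Finset.sum_comm]
  calc ∑ x ∈ P, ∑ t ∈ B, m x t ≤ ∑ x ∈ P, (1 : ℝ) := Finset.sum_le_sum fun x hx => hcap x hx
    _ = (P.card : ℝ) := by simp

/-- **HYPERBOLIC CERTIFICATE ⟹ PRODUCT FORM.**  Sources `x ∈ P`, `y ∈ Q` send nonnegative masses `m₁ x t`, `m₂ y t` to the targets
`t ∈ B`, each source at most one unit in total; if every target receives masses `r₁(t) = Σ_x m₁ x t`, `r₂(t) = Σ_y m₂ y t` with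
`r₁(t) · r₂(t) ≥ 1`, then `#B² ≤ #P · #Q`. [this work] -/
theorem card_sq_le_of_hyperbolicCertificate (B : Finset ι) (P : Finset κ₁) (Q : Finset κ₂)
    (m₁ : κ₁ → ι → ℝ) (m₂ : κ₂ → ι → ℝ)
    (h₁ : ∀ x ∈ P, ∀ t ∈ B, 0 ≤ m₁ x t) (h₂ : ∀ y ∈ Q, ∀ t ∈ B, 0 ≤ m₂ y t)
    (hcap₁ : ∀ x ∈ P, ∑ t ∈ B, m₁ x t ≤ 1) (hcap₂ : ∀ y ∈ Q, ∑ t ∈ B, m₂ y t ≤ 1)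
    (hdem : ∀ t ∈ B, 1 ≤ (∑ x ∈ P, m₁ x t) * (∑ y ∈ Q, m₂ y t)) :
    ((B.card : ℝ)) ^ 2 ≤ (P.card : ℝ) * (Q.card : ℝ) := by
  set r₁ : ι → ℝ := fun t => ∑ x ∈ P, m₁ x t with hr₁
  set r₂ : ι → ℝ := fun t => ∑ y ∈ Q, m₂ y t with hr₂
  have hr₁0 : ∀ t ∈ B, 0 ≤ r₁ t := fun t ht => Finset.sum_nonneg fun x hx => h₁ x hx t ht
  have hr₂0 : ∀ t ∈ B, 0 ≤ r₂ t := fun t ht => Finset.sum_nonneg fun y hy => h₂ y hy t ht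
  -- termwise: 1 ≤ √(r₁ t) · √(r₂ t)
  have hterm : ∀ t ∈ B, (1 : ℝ) ≤ Real.sqrt (r₁ t) * Real.sqrt (r₂ t) := by
    intro t ht
    rw [← Real.sqrt_mul (hr₁0 t ht), ← Real.sqrt_one]
    exact Real.sqrt_le_sqrt (by simpa [hr₁, hr₂] using hdem t ht)
  have hB : (B.card : ℝ) ≤ ∑ t ∈ B, Real.sqrt (r₁ t) * Real.sqrt (r₂ t) := by
    calc (B.card : ℝ) = ∑ t ∈ B, (1 : ℝ) := by simp
      _ ≤ ∑ t ∈ B, Real.sqrt (r₁ t) * Real.sqrt (r₂ t) := Finset.sum_le_sum hterm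
  -- Cauchy–Schwarz
  have hCS : (∑ t ∈ B, Real.sqrt (r₁ t) * Real.sqrt (r₂ t)) ^ 2 ≤
      (∑ t ∈ B, Real.sqrt (r₁ t) ^ 2) * (∑ t ∈ B, Real.sqrt (r₂ t) ^ 2) :=
    Finset.sum_mul_sq_le_sq_mul_sq B (fun t => Real.sqrt (r₁ t)) (fun t => Real.sqrt (r₂ t))
  have hsq₁ : ∑ t ∈ B, Real.sqrt (r₁ t) ^ 2 = ∑ t ∈ B, r₁ t :=
    Finset.sum_congr rfl fun t ht => Real.sq_sqrt (hr₁0 t ht)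
  have hsq₂ : ∑ t ∈ B, Real.sqrt (r₂ t) ^ 2 = ∑ t ∈ B, r₂ t :=
    Finset.sum_congr rfl fun t ht => Real.sq_sqrt (hr₂0 t ht)
  have hS₁ : ∑ t ∈ B, r₁ t ≤ (P.card : ℝ) := sum_received_le_card B P m₁ hcap₁
  have hS₂ : ∑ t ∈ B, r₂ t ≤ (Q.card : ℝ) := sum_received_le_card B Q m₂ hcap₂
  have hS₂0 : 0 ≤ ∑ t ∈ B, r₂ t := Finset.sum_nonneg hr₂0
  calc ((B.card : ℝ)) ^ 2 ≤ (∑ t ∈ B, Real.sqrt (r₁ t) * Real.sqrt (r₂ t)) ^ 2 :=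
        pow_le_pow_left₀ (by positivity) hB 2
    _ ≤ (∑ t ∈ B, r₁ t) * (∑ t ∈ B, r₂ t) := by rw [← hsq₁, ← hsq₂]; exact hCS
    _ ≤ (P.card : ℝ) * (Q.card : ℝ) := mul_le_mul hS₁ hS₂ hS₂0 (by positivity)

/-- The same with a natural-number conclusion. [this work] -/
theorem card_sq_le_of_hyperbolicCertificate_nat (B : Finset ι) (P : Finset κ₁) (Q : Finset κ₂)
    (m₁ : κ₁ → ι → ℝ) (m₂ : κ₂ → ι → ℝ)
    (h₁ : ∀ x ∈ P, ∀ t ∈ B, 0 ≤ m₁ x t) (h₂ : ∀ y ∈ Q, ∀ t ∈ B, 0 ≤ m₂ y t)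
    (hcap₁ : ∀ x ∈ P, ∑ t ∈ B, m₁ x t ≤ 1) (hcap₂ : ∀ y ∈ Q, ∑ t ∈ B, m₂ y t ≤ 1)
    (hdem : ∀ t ∈ B, 1 ≤ (∑ x ∈ P, m₁ x t) * (∑ y ∈ Q, m₂ y t)) :
    B.card ^ 2 ≤ P.card * Q.card := by
  have h := card_sq_le_of_hyperbolicCertificate B P Q m₁ m₂ h₁ h₂ hcap₁ hcap₂ hdem
  exact_mod_cast h

/-! ### 2. The converse: the product form is equivalent to the existence of a certificate -/

/-- **PRODUCT FORM ⟹ HYPERBOLIC CERTIFICATE** (on the complete relations, uniform plan): if `B` is nonempty and `#B² ≤ #P·#Q` then the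
plans `m₁ x t = 1/#B`, `m₂ y t = 1/#B` have capacity `1` and received product `#P·#Q/#B² ≥ 1`.  So per fibre, CONJECTURE (P) is
equivalent to the existence of a hyperbolic certificate. [this work] -/
theorem hyperbolicCertificate_of_card_sq_le (B : Finset ι) (P : Finset κ₁) (Q : Finset κ₂) (hB : B.Nonempty)
    (h : B.card ^ 2 ≤ P.card * Q.card) :
    ∃ m₁ : κ₁ → ι → ℝ, ∃ m₂ : κ₂ → ι → ℝ,
      (∀ x ∈ P, ∀ t ∈ B, 0 ≤ m₁ x t) ∧ (∀ y ∈ Q, ∀ t ∈ B, 0 ≤ m₂ y t) ∧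
      (∀ x ∈ P, ∑ t ∈ B, m₁ x t ≤ 1) ∧ (∀ y ∈ Q, ∑ t ∈ B, m₂ y t ≤ 1) ∧
      (∀ t ∈ B, 1 ≤ (∑ x ∈ P, m₁ x t) * (∑ y ∈ Q, m₂ y t)) := by
  have hBpos : (0 : ℝ) < B.card := by exact_mod_cast hB.card_pos
  have hBne : (B.card : ℝ) ≠ 0 := hBpos.ne'
  refine ⟨fun _ _ => 1 / (B.card : ℝ), fun _ _ => 1 / (B.card : ℝ), ?_, ?_, ?_, ?_, ?_⟩
  · intro x _ t _; positivity
  · intro y _ t _; positivity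
  · intro x _
    rw [Finset.sum_const, nsmul_eq_mul, mul_one_div, div_self hBne]
  · intro y _
    rw [Finset.sum_const, nsmul_eq_mul, mul_one_div, div_self hBne]
  · intro t _
    rw [Finset.sum_const, Finset.sum_const, nsmul_eq_mul, nsmul_eq_mul]
    have hh : ((B.card : ℝ)) ^ 2 ≤ (P.card : ℝ) * (Q.card : ℝ) := by exact_mod_cast h
    rw [mul_one_div, mul_one_div, div_mul_div_comm, le_div_iff₀ (by positivity), one_mul, ← sq]
    exact hh

/-! ### 3. The arithmetic-mean shadow and the integral form -/

/-- AM–GM at one target: hyperbolic demand `r₁ r₂ ≥ 1` implies additive demand `r₁ + r₂ ≥ 2`. [folklore] -/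
theorem additive_of_hyperbolic {r₁ r₂ : ℝ} (h₁ : 0 ≤ r₁) (h₂ : 0 ≤ r₂) (h : 1 ≤ r₁ * r₂) : 2 ≤ r₁ + r₂ := by
  nlinarith [sq_nonneg (r₁ - r₂), sq_nonneg (r₁ + r₂), mul_nonneg h₁ h₂]

/-- **ADDITIVE (demand-2) CERTIFICATE ⟹ ARITHMETIC-MEAN FORM** `2·#B ≤ #P + #Q` (gen 44/53's FIB32 certificate shape; weaker than the
product form by AM–GM). [this work] -/
theorem two_mul_card_le_of_additiveCertificate (B : Finset ι) (P : Finset κ₁) (Q : Finset κ₂)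
    (m₁ : κ₁ → ι → ℝ) (m₂ : κ₂ → ι → ℝ)
    (hcap₁ : ∀ x ∈ P, ∑ t ∈ B, m₁ x t ≤ 1) (hcap₂ : ∀ y ∈ Q, ∑ t ∈ B, m₂ y t ≤ 1)
    (hdem : ∀ t ∈ B, 2 ≤ (∑ x ∈ P, m₁ x t) + (∑ y ∈ Q, m₂ y t)) :
    2 * (B.card : ℝ) ≤ (P.card : ℝ) + (Q.card : ℝ) := by
  have hS₁ := sum_received_le_card B P m₁ hcap₁
  have hS₂ := sum_received_le_card B Q m₂ hcap₂
  calc 2 * (B.card : ℝ) = ∑ t ∈ B, (2 : ℝ) := by simp [mul_comm]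
    _ ≤ ∑ t ∈ B, ((∑ x ∈ P, m₁ x t) + (∑ y ∈ Q, m₂ y t)) := Finset.sum_le_sum hdem
    _ = (∑ t ∈ B, ∑ x ∈ P, m₁ x t) + (∑ t ∈ B, ∑ y ∈ Q, m₂ y t) := Finset.sum_add_distrib
    _ ≤ (P.card : ℝ) + (Q.card : ℝ) := add_le_add hS₁ hS₂

/-- **PAIR INJECTION ⟹ PRODUCT FORM**: a map `B × B → P × Q` injective on `B × B` (the 'two-configuration injection' of gen 53 §8;
the cut-vertex cross-swap is one) gives `#B² ≤ #P·#Q`. [folklore] -/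
theorem card_sq_le_of_pairInjOn (B : Finset ι) (P : Finset κ₁) (Q : Finset κ₂) (Φ : ι × ι → κ₁ × κ₂)
    (hmaps : ∀ p ∈ B ×ˢ B, Φ p ∈ P ×ˢ Q) (hinj : Set.InjOn Φ ↑(B ×ˢ B)) :
    B.card ^ 2 ≤ P.card * Q.card := by
  have h := Finset.card_le_card_of_injOn Φ hmaps hinj
  rwa [Finset.card_product, Finset.card_product, ← sq] at h

/-! ### 4. The product Hall condition (necessary for a certificate on given relations) -/

/-- Restricting a plan to a sub-target-set keeps capacities. [this work] -/
theorem sum_sub_le_one_of_cap {B A : Finset ι} (hA : A ⊆ B) {m : ι → ℝ} (h0 : ∀ t ∈ B, 0 ≤ m t)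
    (hcap : ∑ t ∈ B, m t ≤ 1) : ∑ t ∈ A, m t ≤ 1 :=
  (Finset.sum_le_sum_of_subset_of_nonneg hA fun t ht _ => h0 t ht).trans hcap

/-- **PRODUCT HALL CONDITION.**  If a hyperbolic certificate is supported on relations — `m₁ x t = 0` unless `R₁ x t`, `m₂ y t = 0`
unless `R₂ y t` — then for every `A ⊆ B`, `#A² ≤ #N₁(A) · #N₂(A)` with `Nᵢ(A)` the sources related to some target in `A`.  (Take
`A = B` and trivial relations for `card_sq_le_of_hyperbolicCertificate`; the memo applies it with `#A = 2` to rule out monotone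
relations.) [this work] -/
theorem card_sq_le_neighbour_card_mul_of_hyperbolicCertificate (B : Finset ι) (P : Finset κ₁) (Q : Finset κ₂)
    (R₁ : κ₁ → ι → Prop) (R₂ : κ₂ → ι → Prop) (m₁ : κ₁ → ι → ℝ) (m₂ : κ₂ → ι → ℝ)
    (h₁ : ∀ x ∈ P, ∀ t ∈ B, 0 ≤ m₁ x t) (h₂ : ∀ y ∈ Q, ∀ t ∈ B, 0 ≤ m₂ y t)
    (hsupp₁ : ∀ x ∈ P, ∀ t ∈ B, ¬ R₁ x t → m₁ x t = 0) (hsupp₂ : ∀ y ∈ Q, ∀ t ∈ B, ¬ R₂ y t → m₂ y t = 0)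
    (hcap₁ : ∀ x ∈ P, ∑ t ∈ B, m₁ x t ≤ 1) (hcap₂ : ∀ y ∈ Q, ∑ t ∈ B, m₂ y t ≤ 1)
    (hdem : ∀ t ∈ B, 1 ≤ (∑ x ∈ P, m₁ x t) * (∑ y ∈ Q, m₂ y t))
    (A : Finset ι) (hA : A ⊆ B) :
    ((A.card : ℝ)) ^ 2 ≤
      ((P.filter fun x => ∃ t ∈ A, R₁ x t).card : ℝ) * ((Q.filter fun y => ∃ t ∈ A, R₂ y t).card : ℝ) := by
  set P' := P.filter fun x => ∃ t ∈ A, R₁ x t with hP'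
  set Q' := Q.filter fun y => ∃ t ∈ A, R₂ y t with hQ'
  -- on A, the received masses from P equal those from P' (unrelated sources send 0)
  have hrec₁ : ∀ t ∈ A, ∑ x ∈ P, m₁ x t = ∑ x ∈ P', m₁ x t := by
    intro t ht
    rw [hP', Finset.sum_filter]
    refine Finset.sum_congr rfl fun x hx => ?_
    by_cases hR : ∃ t' ∈ A, R₁ x t'
    · rw [if_pos hR]
    · rw [if_neg hR]
      exact hsupp₁ x hx t (hA ht) fun hxt => hR ⟨t, ht, hxt⟩
  have hrec₂ : ∀ t ∈ A, ∑ y ∈ Q, m₂ y t = ∑ y ∈ Q', m₂ y t := by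
    intro t ht
    rw [hQ', Finset.sum_filter]
    refine Finset.sum_congr rfl fun y hy => ?_
    by_cases hR : ∃ t' ∈ A, R₂ y t'
    · rw [if_pos hR]
    · rw [if_neg hR]
      exact hsupp₂ y hy t (hA ht) fun hyt => hR ⟨t, ht, hyt⟩
  refine card_sq_le_of_hyperbolicCertificate A P' Q' m₁ m₂ ?_ ?_ ?_ ?_ ?_
  · intro x hx t ht; exact h₁ x (Finset.mem_of_mem_filter x hx) t (hA ht)
  · intro y hy t ht; exact h₂ y (Finset.mem_of_mem_filter y hy) t (hA ht)
  · intro x hx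
    exact sum_sub_le_one_of_cap hA (fun t ht => h₁ x (Finset.mem_of_mem_filter x hx) t ht)
      (hcap₁ x (Finset.mem_of_mem_filter x hx))
  · intro y hy
    exact sum_sub_le_one_of_cap hA (fun t ht => h₂ y (Finset.mem_of_mem_filter y hy) t ht)
      (hcap₂ y (Finset.mem_of_mem_filter y hy))
  · intro t ht
    rw [← hrec₁ t ht, ← hrec₂ t ht]
    exact hdem t (hA ht)

end ProductFormCertificate

end Summit.CriticalPhenomena.PercolationContinuityZ3.Theorems
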